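import Summits.QuantumFields.YangMills.Theorems.AlphaInputsT3ACv3DataSchemaSelChi
import Summits.QuantumFields.YangMills.Theorems.UnitScaleTiltHistoryTailOneSupplier
import HarnessLib

/-!
# `AlphaInputsT3ACv3RecordSelChi` — THE RECORD-PARAMETRIC «SELECTION» DISPLAY OF 2′χ, THE REGISTERED 2′χ TEXT AND THE CRUX `HistoryTailL` FROM IT, AND «NOTHING LOST»
# FROM THE (FL)-DISPLAY OF RECORD — lane `pub-balaban3d`, width seat alpha-2 (g7); companion of `AlphaInputsT3ACv3DataSchemaSelChi`

WHY (cell `ym3-torus`, route `UnitScaleTilt`, crux `HistoryTailL` = stmt-QuantumFields-19936, stub 2′χ `stub_laneRecordsV3Chi`; this seat's NODE-O d = 3 bill, located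
points L1∕L2).  With (O‴χ) `AlphaInputsT3AC.DataRowsT3XChiSel` («a measurable IN-CLASS minimiser selection with its χ cluster-expansion data», the sibling file) the
per-family pair {(FL) `InnerFineLiftsT3`, (O″χ) `DataRowsT3XChi` for EVERY argmin selection} of the display of record `PinnedPartsT3ACRecFLChi` collapses to ONE row, and the
collar size `7L + 3 ≤ M₁` is no longer read.  THIS FILE:
* §1 `AlphaInputsT3AC.PinnedPartsT3ACRecSelChi L` — the record-parametric display: thresholds `(b₁, p₁)`; per profile a record with exactly that p-function, [7]-constants in
  print's small-`a₁` regime, `1 ≤ 2B₃`, the three `C68`-rows, (T) `Thm1GlobalMinAt`, and per family (O‴χ) «for some pinned [7]-family whenever one exists».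
* §2 ★★★ `alphaInputsT3ACv3RecChi_of_pinnedPartsRecSelChi : PinnedPartsT3ACRecSelChi L → AlphaInputsT3ACv3RecChi L` and `historyTailL_of_pinnedPartsRecSelChi`.
* §3 ★ NOTHING LOST: `pinnedPartsT3ACRecSelChi_of_recFLChi : PinnedPartsT3ACRecFLChi L → PinnedPartsT3ACRecSelChi L` — per family (FL) ⇒ (D6X-CHARGED)
  (`chargedX_of_fineLifts_cast`) ⇒ (D6X) (collar from `7L + 3 ≤ M₁`, `4π ≤ C68` from the sizes) ⇒ the measurable argmin selector is an in-class selection and (O″χ) hands its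
  data (`dataRowsT3XChiSel_of_dataRows`).  So the (FL) theorem of the KIN line is CONSUMED here, once, instead of standing beside an ∀-over-argmins row.
* §4 the one-supplier twins of ★w5-19936 g0's `HistoryTailOneSupplier` §3–§4 in selection currency: ★★ `pinnedPartsT3ACRecSelChi_of_thm1_rows` ((T) at ANY constants + the
  supplier rows WITHOUT (FL) and WITHOUT `M₁`), `alphaInputsT3ACv3RecChi_of_thm1_selRows`, ★★★ `historyTailL_of_thm1In8_selDataRows_allL` — **stmt-QuantumFields-19936 BY NAME
  = ⟨v5kC's T8 text⟩ ∧ ⟨∀ odd `L > 1`: a floor `B₀`, a box, and per served record∕family∕`(γ, K)` ONE measurable in-class minimiser selection with its [Balaban1985UV3] Sect. B–C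
  χ-data⟩** — print's own shape (its minimiser map + its expansion).
HONEST FRAMING.  `PinnedPartsT3ACRecSelChi` is a HYPOTHESIS SCHEMA (never asserted); every theorem is composition∕bookkeeping of landed theorems; (T), (O‴χ) and T8 stay
hypotheses; the regional-regularity content a supplier needs to place PRINT's minimiser map in `𝒞_X` is [Balaban1985Variational] Thm 1 at non-trivial histories (the KIN
line's (FL) theorem is its existence half) and is NOT proved here; nothing of the cluster expansion is proved.  Count-neutral helper toward 2′χ (`--supports
stmt-QuantumFields-19936`); registry untouched; whether §1 becomes the display of record is the route OWNER's decision.  YM₃ on the three-torus is rung R3 of the programme, not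
the Clay problem: nothing here is a claim about d = 4, infinite volume, or a mass gap.

References: T. Bałaban, Commun. Math. Phys. 102 (1985) 255–275 [Balaban1985UV3] ((5) p.256, (7) p.257, (40)–(42) p.266, (47) p.267, (55) p.269, (68) p.273, (71) p.273, Thm 2
p.272); Commun. Math. Phys. 102 (1985) 277–309 [Balaban1985Variational] (Thm 1 (6)–(8) pp.278–279, Prop 8 p.304); C. King, Commun. Math. Phys. 102 (1986) 649–677 [King1986]
((3.12) p.657).
-/

set_option autoImplicit false

noncomputable section

namespace Summit.QuantumFields.YangMills.Theorems

open MeasureTheory Set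
open scoped Matrix.Norms.L2Operator
open Literature.MathematicalPhysics.QuantumFieldTheory.Balaban1983to89
open Literature.MathematicalPhysics.QuantumFieldTheory.Balaban1983to89.T3ContinuumYM3Torus
open Literature.MathematicalPhysics.QuantumFieldTheory.Balaban1983to89.T3UnitScaleTilt (θBal)
open Literature.MathematicalPhysics.QuantumFieldTheory.Balaban1983to89.T3PrintedMinimiserExistence (Thm1GlobalMinAt)
open Literature.MathematicalPhysics.QuantumFieldTheory.Balaban1983to89.T3LowerAlongMinimisersSplit (MinimisersIn8At)
open Literature.MathematicalPhysics.QuantumFieldTheory.Balaban1983to89.ExpMeanLog (deltaSU)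
open Literature.MathematicalPhysics.QuantumFieldTheory.Balaban1985CMP102.Setting
open Summit.QuantumFields.Balaban3D.Carriers
open Summit.QuantumFields.Balaban3D.Proofs.Primitives
open Summit.QuantumFields.Balaban3D.Proofs.Thresholds (Q0 Q0_pos)
open Summit.QuantumFields.YangMills.Theorems.HistoryTailOneSupplier (exists_small_window)
open B7Prop2Explicit (C0 C0_pos)

/-! ## §1 The record-parametric selection display of 2′χ -/

/-- **2′χ DISPLAYED WITH A HANDED SELECTION** (hypothesis schema, OPEN, never asserted): `PinnedPartsT3ACRecFLChi L` with the per-family pair {(FL), (O″χ)} replaced by the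
single row (O‴χ) `DataRowsT3XChiSel` «for some pinned [7]-family whenever one exists», and WITHOUT the collar size `7L + 3 ≤ M₁` — thresholds `(b₁, p₁)`; for every profile
beyond them a record `𝔠` with exactly that p-function and [7]-constants `a₀, a₁` in print's small-`a₁` regime, `1 ≤ 2B₃`, the three `C68`-rows (all free:
`pinnedPartsT3ACRecR_shell`), (T) `Thm1GlobalMinAt`, and per family (O‴χ).  PRINT'S SHAPE: (T) = [Balaban1985Variational] Thm 1 at the trivial history; (O‴χ) = ITS regional
minimiser map (in `𝒞_X` by Thm 1's regional regularity) with ITS [Balaban1985UV3] Sect. B–C expansion.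
[cite: Balaban1985UV3, (7) p.257, (40)–(42) p.266, (47) p.267, (68) p.273 and Thm 2 p.272; Balaban1985Variational, Thm 1 (6)–(8) pp.278–279] -/
def AlphaInputsT3AC.PinnedPartsT3ACRecSelChi (L : ℕ) : Prop :=
  ∃ (b₁ p₁ : ℝ), ∀ (b₀ p₀ : ℝ), b₁ ≤ b₀ → p₁ ≤ p₀ →
    ∃ (𝔠 : AlphaConsts L (suGroupModel 2).N) (a₀ a₁ : ℝ), 𝔠.b₀ = b₀ ∧ 𝔠.p₀ = p₀ ∧ 0 < a₀ ∧ 0 < a₁ ∧ 𝔠.B₃ * a₁ ≤ a₀ ∧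
      (143 * ((((3 + 4 : ℕ) : ℝ)) ^ 2 / 4) ^ 2) * (2 * (𝔠.B₃ * a₁)) ≤ 1 / 3 ∧
      2 * (2 * (𝔠.B₃ * a₁)) ≤ 2 * deltaSU (Fin 2) / (((3 + 4) * L : ℕ) : ℝ) ^ 2 ∧
      1 ≤ 2 * 𝔠.B₃ ∧ 4 * 𝔠.B₃ * (L : ℝ) ^ 2 * avgWindowFactor L ≤ 𝔠.C68 ∧
      Real.exp (𝔠.p₀ - 1) ≤ 3 * C0 3 * 𝔠.C68 * (𝔠.b₀ * Q0 𝔠.p₀) ∧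
      (𝔠.b₀ * Q0 𝔠.p₀) * (2 * (L : ℝ) ^ 2 * avgWindowFactor L) ^ 2 ≤ 3 * C0 3 * 𝔠.C68 * a₁ ^ 2 ∧
      Thm1GlobalMinAt L a₀ a₁ 𝔠.B₃ ∧
      ∀ (F : T3Family) (hF : F.L = L) (γ : ℝ) (hγ : 0 < γ) (hγ1 : γ ≤ (min (hF ▸ 𝔠).gamma0 1) ^ 2) (K : ℕ),
        (∃ Ut : (k : ℕ) → GaugeField (F.P K) k (Matrix.specialUnitaryGroup (Fin 2) ℂ) → GaugeField (F.P K) 0 (Matrix.specialUnitaryGroup (Fin 2) ℂ),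
          AlphaInputsT3AC.TrivMinimiserRowsT3 F (hF ▸ 𝔠) γ hγ hγ1 a₀ a₁ K Ut) →
        ∃ Ut : (k : ℕ) → GaugeField (F.P K) k (Matrix.specialUnitaryGroup (Fin 2) ℂ) → GaugeField (F.P K) 0 (Matrix.specialUnitaryGroup (Fin 2) ℂ),
          AlphaInputsT3AC.TrivMinimiserRowsT3 F (hF ▸ 𝔠) γ hγ hγ1 a₀ a₁ K Ut ∧ AlphaInputsT3AC.DataRowsT3XChiSel F (hF ▸ 𝔠) γ hγ hγ1 K Ut

/-! ## §2 The registered 2′χ text and the crux from the selection display -/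

/-- At a family of block size `L` the body of `PinnedPartsT3ACRecSelChi` gives `OfV3ChiAt` (the sibling's `ofV3ChiAt_of_pinnedRows₂SelChi` after transport along `hF`).
[cite: Balaban1985UV3, Thm 2 p.272 + (47) p.267; Balaban1985Variational, Thm 1 (8) p.279] -/
theorem AlphaInputsT3AC.ofV3ChiAt_of_pinnedPartsSelChi_cast {L : ℕ} {𝔠 : AlphaConsts L (suGroupModel 2).N} {a₀ a₁ : ℝ}
    (ha₁ : 0 < a₁) (hwin : 𝔠.B₃ * a₁ ≤ a₀)
    (hA3 : (143 * ((((3 + 4 : ℕ) : ℝ)) ^ 2 / 4) ^ 2) * (2 * (𝔠.B₃ * a₁)) ≤ 1 / 3)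
    (hA2 : 2 * (2 * (𝔠.B₃ * a₁)) ≤ 2 * deltaSU (Fin 2) / (((3 + 4) * L : ℕ) : ℝ) ^ 2)
    (hB₃ : 1 ≤ 2 * 𝔠.B₃) (hC : 4 * 𝔠.B₃ * (L : ℝ) ^ 2 * avgWindowFactor L ≤ 𝔠.C68)
    (hCe : Real.exp (𝔠.p₀ - 1) ≤ 3 * C0 3 * 𝔠.C68 * (𝔠.b₀ * Q0 𝔠.p₀))
    (hCa : (𝔠.b₀ * Q0 𝔠.p₀) * (2 * (L : ℝ) ^ 2 * avgWindowFactor L) ^ 2 ≤ 3 * C0 3 * 𝔠.C68 * a₁ ^ 2)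
    (hT : Thm1GlobalMinAt L a₀ a₁ 𝔠.B₃) (F : T3Family) (hF : F.L = L)
    (hrows : ∀ (γ : ℝ) (hγ : 0 < γ) (hγ1 : γ ≤ (min (hF ▸ 𝔠).gamma0 1) ^ 2) (K : ℕ),
      (∃ Ut : (k : ℕ) → GaugeField (F.P K) k (Matrix.specialUnitaryGroup (Fin 2) ℂ) → GaugeField (F.P K) 0 (Matrix.specialUnitaryGroup (Fin 2) ℂ),
        AlphaInputsT3AC.TrivMinimiserRowsT3 F (hF ▸ 𝔠) γ hγ hγ1 a₀ a₁ K Ut) →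
      ∃ Ut : (k : ℕ) → GaugeField (F.P K) k (Matrix.specialUnitaryGroup (Fin 2) ℂ) → GaugeField (F.P K) 0 (Matrix.specialUnitaryGroup (Fin 2) ℂ),
        AlphaInputsT3AC.TrivMinimiserRowsT3 F (hF ▸ 𝔠) γ hγ hγ1 a₀ a₁ K Ut ∧ AlphaInputsT3AC.DataRowsT3XChiSel F (hF ▸ 𝔠) γ hγ hγ1 K Ut) :
    AlphaInputsT3AC.OfV3ChiAt F (hF ▸ 𝔠) a₀ a₁ := by
  subst hF
  exact AlphaInputsT3AC.ofV3ChiAt_of_pinnedRows₂SelChi F 𝔠 hT ha₁ hwin hA3 hA2 hB₃ hC hCe hCa hrows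

/-- ★★★ **THE STUB 2′χ FROM ITS SELECTION DISPLAY**: `PinnedPartsT3ACRecSelChi L → AlphaInputsT3ACv3RecChi L` — 2′χ `stub_laneRecordsV3Chi` re-cut to «(T) [7] Thm 1 + the
record sizes + (O‴χ) ONE measurable in-class minimiser selection with its χ data rows», with NO kinematic row ((FL)∕(D6X)) and NO collar size.
[cite: Balaban1985UV3, Thm 2 p.272 + (47) p.267; Balaban1985Variational, Thm 1 (8) p.279] -/
theorem alphaInputsT3ACv3RecChi_of_pinnedPartsRecSelChi {L : ℕ} (h : AlphaInputsT3AC.PinnedPartsT3ACRecSelChi L) : AlphaInputsT3ACv3RecChi L := by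
  obtain ⟨b₁, p₁, h⟩ := h
  refine ⟨b₁, p₁, fun b₀ p₀ hb hp => ?_⟩
  obtain ⟨𝔠, a₀, a₁, h1, h2, h3, h4, h5, hA3, hA2, hB₃, hC, hCe, hCa, hT, hD⟩ := h b₀ p₀ hb hp
  exact ⟨𝔠, a₀, a₁, h1, h2, h3, h4, h5, fun F hF =>
    AlphaInputsT3AC.ofV3ChiAt_of_pinnedPartsSelChi_cast h4 h5 hA3 hA2 hB₃ hC hCe hCa hT F hF (hD F hF)⟩

/-- **`HistoryTailL` FROM THE SELECTION DISPLAY at every odd block size `L > 1`** (`historyTailL_of_laneRecordsChi ∘ alphaInputsT3ACv3RecChi_of_pinnedPartsRecSelChi`) —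
stmt-QuantumFields-19936 PROVED MODULO the displayed predicate, not a proof of the crux. [cite: Balaban1985UV3, (5) p.256, (47) p.267 and (71) p.273; Balaban1985Variational, Thm 1 (8) p.279] -/
theorem historyTailL_of_pinnedPartsRecSelChi
    (h : ∀ L : ℕ, Odd L → 1 < L → AlphaInputsT3AC.PinnedPartsT3ACRecSelChi L) :
    Summit.QuantumFields.YangMills.Theses.UnitScaleTilt.HistoryTailL :=
  HistoryTailLaneTailChi.historyTailL_of_laneRecordsChi fun L hLo hL => alphaInputsT3ACv3RecChi_of_pinnedPartsRecSelChi (h L hLo hL)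

/-! ## §3 NOTHING LOST: the (FL)-display of record implies the selection display -/

/-- At a family of block size `L`: the record sizes (incl. the collar `7L + 3 ≤ M₁`), the per-family (FL) row and the per-family (O″χ) row of `PinnedPartsT3ACRecFLChi` give
the per-family (O‴χ) row — (FL) ⇒ (D6X-CHARGED) (`chargedX_of_fineLifts_cast`), the uncharged half from the collar (`adaptedClassNonemptyT3X_of_charged_of_collar`), then
`dataRowsT3XChiSel_of_dataRows` (the measurable argmin selector is an in-class selection).  This is where the KIN line's (FL) theorem is consumed.
[cite: Balaban1985UV3, (42) p.266 + (67)–(68) p.273; Balaban1985Variational, Thm 1 (8) p.279] -/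
theorem AlphaInputsT3AC.selRows_of_fineLifts_dataRows_cast {L : ℕ} {𝔠 : AlphaConsts L (suGroupModel 2).N} {a₀ a₁ : ℝ} (ha₁ : 0 < a₁)
    (hA3 : (143 * ((((3 + 4 : ℕ) : ℝ)) ^ 2 / 4) ^ 2) * (2 * (𝔠.B₃ * a₁)) ≤ 1 / 3)
    (hA2 : 2 * (2 * (𝔠.B₃ * a₁)) ≤ 2 * deltaSU (Fin 2) / (((3 + 4) * L : ℕ) : ℝ) ^ 2)
    (hB₃ : 1 ≤ 2 * 𝔠.B₃) (hC : 4 * 𝔠.B₃ * (L : ℝ) ^ 2 * avgWindowFactor L ≤ 𝔠.C68)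
    (hCe : Real.exp (𝔠.p₀ - 1) ≤ 3 * C0 3 * 𝔠.C68 * (𝔠.b₀ * Q0 𝔠.p₀))
    (hCa : (𝔠.b₀ * Q0 𝔠.p₀) * (2 * (L : ℝ) ^ 2 * avgWindowFactor L) ^ 2 ≤ 3 * C0 3 * 𝔠.C68 * a₁ ^ 2)
    (hM₁ : 7 * L + 3 ≤ 𝔠.M₁) (F : T3Family) (hF : F.L = L)
    (hFL : ∀ (γ : ℝ) (hγ : 0 < γ) (hγ1 : γ ≤ (min (hF ▸ 𝔠).gamma0 1) ^ 2) (K : ℕ),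
      AlphaInputsT3AC.InnerFineLiftsT3 F (hF ▸ 𝔠) γ hγ hγ1 K (hF ▸ 𝔠).B₃)
    (hO : ∀ (γ : ℝ) (hγ : 0 < γ) (hγ1 : γ ≤ (min (hF ▸ 𝔠).gamma0 1) ^ 2) (K : ℕ),
      (∃ Ut : (k : ℕ) → GaugeField (F.P K) k (Matrix.specialUnitaryGroup (Fin 2) ℂ) → GaugeField (F.P K) 0 (Matrix.specialUnitaryGroup (Fin 2) ℂ),
        AlphaInputsT3AC.TrivMinimiserRowsT3 F (hF ▸ 𝔠) γ hγ hγ1 a₀ a₁ K Ut) →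
      ∃ Ut : (k : ℕ) → GaugeField (F.P K) k (Matrix.specialUnitaryGroup (Fin 2) ℂ) → GaugeField (F.P K) 0 (Matrix.specialUnitaryGroup (Fin 2) ℂ),
        AlphaInputsT3AC.TrivMinimiserRowsT3 F (hF ▸ 𝔠) γ hγ hγ1 a₀ a₁ K Ut ∧ AlphaInputsT3AC.DataRowsT3XChi F (hF ▸ 𝔠) γ hγ hγ1 K Ut) :
    ∀ (γ : ℝ) (hγ : 0 < γ) (hγ1 : γ ≤ (min (hF ▸ 𝔠).gamma0 1) ^ 2) (K : ℕ),
      (∃ Ut : (k : ℕ) → GaugeField (F.P K) k (Matrix.specialUnitaryGroup (Fin 2) ℂ) → GaugeField (F.P K) 0 (Matrix.specialUnitaryGroup (Fin 2) ℂ),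
        AlphaInputsT3AC.TrivMinimiserRowsT3 F (hF ▸ 𝔠) γ hγ hγ1 a₀ a₁ K Ut) →
      ∃ Ut : (k : ℕ) → GaugeField (F.P K) k (Matrix.specialUnitaryGroup (Fin 2) ℂ) → GaugeField (F.P K) 0 (Matrix.specialUnitaryGroup (Fin 2) ℂ),
        AlphaInputsT3AC.TrivMinimiserRowsT3 F (hF ▸ 𝔠) γ hγ hγ1 a₀ a₁ K Ut ∧ AlphaInputsT3AC.DataRowsT3XChiSel F (hF ▸ 𝔠) γ hγ hγ1 K Ut := by
  have hXC := AlphaInputsT3AC.chargedX_of_fineLifts_cast ha₁ hA3 hA2 hB₃ hC hCe hCa hM₁ F hF hFL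
  subst hF
  intro γ hγ hγ1 K hex
  obtain ⟨Ut, hUt, hD⟩ := hO γ hγ hγ1 K hex
  have hne : AlphaInputsT3AC.AdaptedClassNonemptyT3X F 𝔠 γ hγ hγ1 K :=
    AlphaInputsT3AC.adaptedClassNonemptyT3X_of_charged_of_collar
      (AlphaInputsT3AC.collarE_T3_of_M₁_ge (hγ := hγ) (hγ1 := hγ1) (K := K) hM₁)
      (AlphaInputsT3AC.four_pi_le_C68_of_sizes (𝔠 := 𝔠) hB₃ hC) (hXC γ hγ hγ1 K)
  exact ⟨Ut, hUt, AlphaInputsT3AC.dataRowsT3XChiSel_of_dataRows hne hUt.1 hUt.2.1 hD⟩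

/-- ★ **NOTHING LOST: THE (FL)-DISPLAY OF RECORD IMPLIES THE SELECTION DISPLAY** (`PinnedPartsT3ACRecFLChi L → PinnedPartsT3ACRecSelChi L`, same record, row by row; the
collar size is consumed and dropped). [cite: Balaban1985UV3, Thm 2 p.272 + (42) p.266; Balaban1985Variational, Thm 1 (8) p.279] -/
theorem AlphaInputsT3AC.pinnedPartsT3ACRecSelChi_of_recFLChi {L : ℕ} (h : AlphaInputsT3AC.PinnedPartsT3ACRecFLChi L) :
    AlphaInputsT3AC.PinnedPartsT3ACRecSelChi L := by
  obtain ⟨b₁, p₁, h⟩ := h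
  refine ⟨b₁, p₁, fun b₀ p₀ hb hp => ?_⟩
  obtain ⟨𝔠, a₀, a₁, h1, h2, h3, h4, h5, hA3, hA2, hB₃, hC, hCe, hCa, hM₁, hT, hD⟩ := h b₀ p₀ hb hp
  exact ⟨𝔠, a₀, a₁, h1, h2, h3, h4, h5, hA3, hA2, hB₃, hC, hCe, hCa, hT, fun F hF =>
    AlphaInputsT3AC.selRows_of_fineLifts_dataRows_cast h4 hA3 hA2 hB₃ hC hCe hCa hM₁ F hF (hD F hF).1 (hD F hF).2⟩

end Summit.QuantumFields.YangMills.Theorems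

/-! ## §4 The one-supplier twins in selection currency -/

namespace Summit.QuantumFields.YangMills.Theorems.HistoryTailSelSupplier

open MeasureTheory Set
open scoped Matrix.Norms.L2Operator
open Literature.MathematicalPhysics.QuantumFieldTheory.Balaban1983to89
open Literature.MathematicalPhysics.QuantumFieldTheory.Balaban1983to89.T3ContinuumYM3Torus
open Literature.MathematicalPhysics.QuantumFieldTheory.Balaban1983to89.T3PrintedMinimiserExistence (Thm1GlobalMinAt)
open Literature.MathematicalPhysics.QuantumFieldTheory.Balaban1983to89.T3LowerAlongMinimisersSplit (MinimisersIn8At)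
open Literature.MathematicalPhysics.QuantumFieldTheory.Balaban1983to89.ExpMeanLog (deltaSU)
open Literature.MathematicalPhysics.QuantumFieldTheory.Balaban1985CMP102.Setting
open Summit.QuantumFields.Balaban3D.Carriers
open Summit.QuantumFields.Balaban3D.Proofs.Primitives
open Summit.QuantumFields.Balaban3D.Proofs.Thresholds (Q0 Q0_pos)
open Summit.QuantumFields.YangMills.Theorems.HistoryTailOneSupplier (exists_small_window)
open B7Prop2Explicit (C0 C0_pos)

/-- ★★ **THE SELECTION DISPLAY FROM (T) AT ANY CONSTANTS AND THE SUPPLIER ROWS** — ★w5-19936 g0's `pinnedPartsT3ACRecFLChi_of_thm1_rows` in selection currency: `hT` —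
[Balaban1985Variational] Thm 1 (global reading) at SOME `(a₀, a₁, B₃) > 0`; `hrows` — for every `B ≥ B₀` with `1 ≤ 2B` and every `(a₀, a₁)` in the box with `B·a₁ ≤ a₀`, the two
small-`a₁` rows and `Thm1GlobalMinAt L a₀ a₁ B` (usable), thresholds `(b₁, p₁)` beyond which every profile is served by a record with exactly that profile, `B₃ = B`, the three
`C68`-rows, and per family∕`(γ, K)` the row (O‴χ) for some pinned [7]-family whenever one exists — NO (FL), NO `M₁`.  (`B := max (max B₃ᵀ B₀) ½`; `exists_small_window`;
`thm1GlobalMinAt_anti`∕`_mono`.) [cite: Balaban1985Variational, Thm 1 (6)–(8) pp.278–279; Balaban1985UV3, (7) p.257, (40)–(42) p.266, (47) p.267, (68) p.273 and Thm 2 p.272] -/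
theorem pinnedPartsT3ACRecSelChi_of_thm1_rows {L : ℕ} (hL : 1 < L)
    (hT : ∃ a₀ a₁ B₃ : ℝ, 0 < a₀ ∧ 0 < a₁ ∧ 0 < B₃ ∧ Thm1GlobalMinAt L a₀ a₁ B₃)
    {B₀ A₀ A₁ : ℝ} (hA₀ : 0 < A₀) (hA₁ : 0 < A₁)
    (hrows : ∀ (B a₀ a₁ : ℝ), B₀ ≤ B → 1 ≤ 2 * B → 0 < a₀ → a₀ ≤ A₀ → 0 < a₁ → a₁ ≤ A₁ → B * a₁ ≤ a₀ →
      (143 * ((((3 + 4 : ℕ) : ℝ)) ^ 2 / 4) ^ 2) * (2 * (B * a₁)) ≤ 1 / 3 →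
      2 * (2 * (B * a₁)) ≤ 2 * deltaSU (Fin 2) / (((3 + 4) * L : ℕ) : ℝ) ^ 2 →
      Thm1GlobalMinAt L a₀ a₁ B →
      ∃ (b₁ p₁ : ℝ), ∀ (b₀ p₀ : ℝ), b₁ ≤ b₀ → p₁ ≤ p₀ →
        ∃ 𝔠 : AlphaConsts L (suGroupModel 2).N, 𝔠.b₀ = b₀ ∧ 𝔠.p₀ = p₀ ∧ 𝔠.B₃ = B ∧
          4 * 𝔠.B₃ * (L : ℝ) ^ 2 * avgWindowFactor L ≤ 𝔠.C68 ∧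
          Real.exp (𝔠.p₀ - 1) ≤ 3 * C0 3 * 𝔠.C68 * (𝔠.b₀ * Q0 𝔠.p₀) ∧
          (𝔠.b₀ * Q0 𝔠.p₀) * (2 * (L : ℝ) ^ 2 * avgWindowFactor L) ^ 2 ≤ 3 * C0 3 * 𝔠.C68 * a₁ ^ 2 ∧
          ∀ (F : T3Family) (hF : F.L = L) (γ : ℝ) (hγ : 0 < γ) (hγ1 : γ ≤ (min (hF ▸ 𝔠).gamma0 1) ^ 2) (K : ℕ),
            (∃ Ut : (k : ℕ) → GaugeField (F.P K) k (Matrix.specialUnitaryGroup (Fin 2) ℂ) →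
                GaugeField (F.P K) 0 (Matrix.specialUnitaryGroup (Fin 2) ℂ),
              AlphaInputsT3AC.TrivMinimiserRowsT3 F (hF ▸ 𝔠) γ hγ hγ1 a₀ a₁ K Ut) →
            ∃ Ut : (k : ℕ) → GaugeField (F.P K) k (Matrix.specialUnitaryGroup (Fin 2) ℂ) →
                GaugeField (F.P K) 0 (Matrix.specialUnitaryGroup (Fin 2) ℂ),
              AlphaInputsT3AC.TrivMinimiserRowsT3 F (hF ▸ 𝔠) γ hγ hγ1 a₀ a₁ K Ut ∧
                AlphaInputsT3AC.DataRowsT3XChiSel F (hF ▸ 𝔠) γ hγ hγ1 K Ut) :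
    AlphaInputsT3AC.PinnedPartsT3ACRecSelChi L := by
  obtain ⟨aT₀, aT₁, BT, haT₀, haT₁, hBT, hT⟩ := hT
  -- the record's `B₃`: above 19200's `B₃`, the supplier's floor and `½`
  set B : ℝ := max (max BT B₀) (1 / 2) with hB_def
  have hBT_le : BT ≤ B := (le_max_left _ _).trans (le_max_left _ _)
  have hB₀_le : B₀ ≤ B := (le_max_right _ _).trans (le_max_left _ _)
  have hBhalf : 1 / 2 ≤ B := le_max_right _ _
  have hBpos : 0 < B := lt_of_lt_of_le (by norm_num) hBhalf
  have h2B : 1 ≤ 2 * B := by linarith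
  -- the [7] constants inside the box and below 19200's
  obtain ⟨a₀, a₁, ha₀, ha₀A, ha₁, ha₁A, hwin, hA3, hA2⟩ :=
    exists_small_window hL hBpos (lt_min hA₀ haT₀) (lt_min hA₁ haT₁)
  have hT' : Thm1GlobalMinAt L a₀ a₁ B :=
    MinimiserPin.thm1GlobalMinAt_mono
      (MinimiserPin.thm1GlobalMinAt_anti hT (ha₀A.trans (min_le_right _ _)) (ha₁A.trans (min_le_right _ _))) le_rfl hBT_le
  obtain ⟨b₁, p₁, hrec⟩ := hrows B a₀ a₁ hB₀_le h2B ha₀ (ha₀A.trans (min_le_left _ _)) ha₁ (ha₁A.trans (min_le_left _ _))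
    hwin hA3 hA2 hT'
  refine ⟨b₁, p₁, fun b₀ p₀ hb hp => ?_⟩
  obtain ⟨𝔠, h1, h2, hB3, s1, s2, s3, hFO⟩ := hrec b₀ p₀ hb hp
  refine ⟨𝔠, a₀, a₁, h1, h2, ha₀, ha₁, by rw [hB3]; exact hwin, by rw [hB3]; exact hA3, by rw [hB3]; exact hA2,
    by rw [hB3]; exact h2B, s1, s2, s3, by rw [hB3]; exact hT', fun F hF => hFO F hF⟩

/-- ★★ **THE REGISTERED 2′χ TEXT `AlphaInputsT3ACv3RecChi L` FROM (T) AT ANY CONSTANTS AND THE SELECTION SUPPLIER ROWS** (§ above through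
`alphaInputsT3ACv3RecChi_of_pinnedPartsRecSelChi`); serves 20520's v5kC identically (its T8 stub supplies `hT`). [cite: Balaban1985UV3, Thm 2 p.272 and (47) p.267; Balaban1985Variational, Thm 1 (8) p.279] -/
theorem alphaInputsT3ACv3RecChi_of_thm1_selRows {L : ℕ} (hL : 1 < L)
    (hT : ∃ a₀ a₁ B₃ : ℝ, 0 < a₀ ∧ 0 < a₁ ∧ 0 < B₃ ∧ Thm1GlobalMinAt L a₀ a₁ B₃)
    {B₀ A₀ A₁ : ℝ} (hA₀ : 0 < A₀) (hA₁ : 0 < A₁)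
    (hrows : ∀ (B a₀ a₁ : ℝ), B₀ ≤ B → 1 ≤ 2 * B → 0 < a₀ → a₀ ≤ A₀ → 0 < a₁ → a₁ ≤ A₁ → B * a₁ ≤ a₀ →
      (143 * ((((3 + 4 : ℕ) : ℝ)) ^ 2 / 4) ^ 2) * (2 * (B * a₁)) ≤ 1 / 3 →
      2 * (2 * (B * a₁)) ≤ 2 * deltaSU (Fin 2) / (((3 + 4) * L : ℕ) : ℝ) ^ 2 →
      Thm1GlobalMinAt L a₀ a₁ B →
      ∃ (b₁ p₁ : ℝ), ∀ (b₀ p₀ : ℝ), b₁ ≤ b₀ → p₁ ≤ p₀ →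
        ∃ 𝔠 : AlphaConsts L (suGroupModel 2).N, 𝔠.b₀ = b₀ ∧ 𝔠.p₀ = p₀ ∧ 𝔠.B₃ = B ∧
          4 * 𝔠.B₃ * (L : ℝ) ^ 2 * avgWindowFactor L ≤ 𝔠.C68 ∧
          Real.exp (𝔠.p₀ - 1) ≤ 3 * C0 3 * 𝔠.C68 * (𝔠.b₀ * Q0 𝔠.p₀) ∧
          (𝔠.b₀ * Q0 𝔠.p₀) * (2 * (L : ℝ) ^ 2 * avgWindowFactor L) ^ 2 ≤ 3 * C0 3 * 𝔠.C68 * a₁ ^ 2 ∧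
          ∀ (F : T3Family) (hF : F.L = L) (γ : ℝ) (hγ : 0 < γ) (hγ1 : γ ≤ (min (hF ▸ 𝔠).gamma0 1) ^ 2) (K : ℕ),
            (∃ Ut : (k : ℕ) → GaugeField (F.P K) k (Matrix.specialUnitaryGroup (Fin 2) ℂ) →
                GaugeField (F.P K) 0 (Matrix.specialUnitaryGroup (Fin 2) ℂ),
              AlphaInputsT3AC.TrivMinimiserRowsT3 F (hF ▸ 𝔠) γ hγ hγ1 a₀ a₁ K Ut) →
            ∃ Ut : (k : ℕ) → GaugeField (F.P K) k (Matrix.specialUnitaryGroup (Fin 2) ℂ) →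
                GaugeField (F.P K) 0 (Matrix.specialUnitaryGroup (Fin 2) ℂ),
              AlphaInputsT3AC.TrivMinimiserRowsT3 F (hF ▸ 𝔠) γ hγ hγ1 a₀ a₁ K Ut ∧
                AlphaInputsT3AC.DataRowsT3XChiSel F (hF ▸ 𝔠) γ hγ hγ1 K Ut) :
    AlphaInputsT3ACv3RecChi L :=
  alphaInputsT3ACv3RecChi_of_pinnedPartsRecSelChi (pinnedPartsT3ACRecSelChi_of_thm1_rows hL hT hA₀ hA₁ hrows)

/-- ★★★ **`HistoryTailL` ⇐ ⟨v5kC's `stub_thm1In8GlobalMin` TEXT⟩ ∧ (∀ odd `L > 1`, THE SELECTION SUPPLIER ROWS)** — stmt-QuantumFields-19936 BY NAME from 19200's T8 text and, at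
every odd block size, a floor `B₀` and a box `(0, A₀] × (0, A₁]` on which the record rows and, per family∕`(γ, K)`, ONE measurable in-class minimiser selection with its
[Balaban1985UV3] Sect. B–C χ-data (O‴χ) are served — print's own shape; NO (FL) row, NO collar size.  ★w5-19936 g0's `historyTailL_of_thm1In8_rows_allL` in selection currency.
[cite: Balaban1985UV3, (5) p.256, (47) p.267, (71) p.273 and Thm 2 p.272; Balaban1985Variational, Thm 1 (8) p.279 and Prop 8 p.304; King1986, (3.12) p.657] -/
theorem historyTailL_of_thm1In8_selDataRows_allL
    (hT8 : ∀ L : ℕ, Odd L → 1 < L → ∃ a₀ a₁ B₃ : ℝ, 0 < a₀ ∧ 0 < a₁ ∧ 0 < B₃ ∧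
      Thm1GlobalMinAt L a₀ a₁ B₃ ∧ MinimisersIn8At L a₀ a₁ B₃)
    (hrows : ∀ L : ℕ, Odd L → 1 < L → ∃ (B₀ A₀ A₁ : ℝ), 0 < A₀ ∧ 0 < A₁ ∧
      ∀ (B a₀ a₁ : ℝ), B₀ ≤ B → 1 ≤ 2 * B → 0 < a₀ → a₀ ≤ A₀ → 0 < a₁ → a₁ ≤ A₁ → B * a₁ ≤ a₀ →
        (143 * ((((3 + 4 : ℕ) : ℝ)) ^ 2 / 4) ^ 2) * (2 * (B * a₁)) ≤ 1 / 3 →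
        2 * (2 * (B * a₁)) ≤ 2 * deltaSU (Fin 2) / (((3 + 4) * L : ℕ) : ℝ) ^ 2 →
        Thm1GlobalMinAt L a₀ a₁ B →
        ∃ (b₁ p₁ : ℝ), ∀ (b₀ p₀ : ℝ), b₁ ≤ b₀ → p₁ ≤ p₀ →
          ∃ 𝔠 : AlphaConsts L (suGroupModel 2).N, 𝔠.b₀ = b₀ ∧ 𝔠.p₀ = p₀ ∧ 𝔠.B₃ = B ∧
            4 * 𝔠.B₃ * (L : ℝ) ^ 2 * avgWindowFactor L ≤ 𝔠.C68 ∧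
            Real.exp (𝔠.p₀ - 1) ≤ 3 * C0 3 * 𝔠.C68 * (𝔠.b₀ * Q0 𝔠.p₀) ∧
            (𝔠.b₀ * Q0 𝔠.p₀) * (2 * (L : ℝ) ^ 2 * avgWindowFactor L) ^ 2 ≤ 3 * C0 3 * 𝔠.C68 * a₁ ^ 2 ∧
            ∀ (F : T3Family) (hF : F.L = L) (γ : ℝ) (hγ : 0 < γ) (hγ1 : γ ≤ (min (hF ▸ 𝔠).gamma0 1) ^ 2) (K : ℕ),
              (∃ Ut : (k : ℕ) → GaugeField (F.P K) k (Matrix.specialUnitaryGroup (Fin 2) ℂ) →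
                  GaugeField (F.P K) 0 (Matrix.specialUnitaryGroup (Fin 2) ℂ),
                AlphaInputsT3AC.TrivMinimiserRowsT3 F (hF ▸ 𝔠) γ hγ hγ1 a₀ a₁ K Ut) →
              ∃ Ut : (k : ℕ) → GaugeField (F.P K) k (Matrix.specialUnitaryGroup (Fin 2) ℂ) →
                  GaugeField (F.P K) 0 (Matrix.specialUnitaryGroup (Fin 2) ℂ),
                AlphaInputsT3AC.TrivMinimiserRowsT3 F (hF ▸ 𝔠) γ hγ hγ1 a₀ a₁ K Ut ∧
                  AlphaInputsT3AC.DataRowsT3XChiSel F (hF ▸ 𝔠) γ hγ hγ1 K Ut) :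
    Summit.QuantumFields.YangMills.Theses.UnitScaleTilt.HistoryTailL := by
  refine historyTailL_of_pinnedPartsRecSelChi fun L hLo hL => ?_
  obtain ⟨a₀, a₁, B₃, ha₀, ha₁, hB₃, hT, -⟩ := hT8 L hLo hL
  obtain ⟨B₀, A₀, A₁, hA₀, hA₁, h⟩ := hrows L hLo hL
  exact pinnedPartsT3ACRecSelChi_of_thm1_rows hL ⟨a₀, a₁, B₃, ha₀, ha₁, hB₃, hT⟩ hA₀ hA₁ h

end Summit.QuantumFields.YangMills.Theorems.HistoryTailSelSupplier

end
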